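/-
pub-lace10 cell, TYPER seat (unit `pub-lace10-typer-g0`), Level B of the `d = 10` programme (lead RULING D7/D8/D11): the CELL REDUCTION of the
`h2phi` numerator `F3Bounds.boundHD75Phi` (module `NobleWeightedDiagramBoundPhi`, p328701) at the ALTERNATIVE true SRW tables `srwTrueAlt d α̲ ᾱ` —
the verbatim twins of `F3BoundsCellReduction` §1–§2, `F3BoundsCellReductionAlt` §2–§3 and `F3BoundsCellSplitAlt` §1–§4 with `boundHD75` replaced by
`boundHD75Phi` (so WITHOUT the hypothesis (H-Γ) `Γ₂′ⁿ·β_{R,Φ} ≤ β_{ΔR,Φ}`), the `ℚ` mirror `boundHD75PhiQ` (twin of `F3BoundsCellNumQ`), the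
pointwise majorant `ℋ ≤ boundHD75Phi (srwTrueAlt …)` (twin of `NobleWeightedDiagramBoundSmallXAlt` §1), and the bridge `ℋ^{n,l}_p(e_i) = ℋ^{n,l+1}_p(0)`
(lead D11 (d)).  Additive: no existing module is modified; d-generic; no numeral; no named fact; no dimension sentence.
-/
import Literature.Probability.FitznerVanDerHofstad2017.NobleWeightedDiagramBoundPhi
import Literature.Probability.FitznerVanDerHofstad2017.NobleF3TrueTablesAlt
import Literature.Probability.FitznerVanDerHofstad2017.F3BoundsCellSplitAlt
import Literature.Probability.FitznerVanDerHofstad2017.F3BoundsCellReductionAlt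
import Literature.Probability.FitznerVanDerHofstad2017.F3BoundsCellNumQ
import Literature.Probability.FitznerVanDerHofstad2017.WeightedBubbleSkeletonF3
import HarnessLib

/-!
# Cell reduction of the `h2phi` numerator `boundHD75Phi` at the alternative true SRW tables

CITATION HEADER (PLACEMENT v2). Part of a certified REPRODUCTION of R. Fitzner, R. van der Hofstad, *Generalized approach to the
non-backtracking lace expansion*, PTRF **169** (2017) 1041–1119 [NoBLE17], §3.3.5 (3.61)–(3.64) (Step 1 and the table `IM`), (3.71)–(3.87)
(the bounds `BoundH[i](n,l,x)`, linear in the SRW tables with non-negative coefficients, read as suprema over the cells `S ∈ {𝒳, {0}}`),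
§3.3.4 (3.34)–(3.35) p. 1071 (the Fourier representation of `ℋ^{n,l}_p(x)`), and of R. Fitzner, R. van der Hofstad, *Mean-field behavior for
nearest-neighbor percolation in `d > 10`*, EJP **22** (2017) no. 43 [FvdH17], §2.5:

> [NoBLE17] (3.87): "`f₃(z) ≤ max_{{n,l,S} ∈ 𝒮} sup_{x ∈ S} (Σ_{i=1}^5 BoundH[i](n,l,x)) / c_{n,l,S}`".

Every `[cite:]` tag below is a LOCATOR for comparison, not an appeal to authority: all statements are proved here from tree theorems.
THE ONE DIFFERENCE from the landed `boundHD75` chain: Step 2 is read in the form PROVED by `NobleH2Step.abs_integral_H2_diagram_le` (:281),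
`… + ᾱ_F·β_{R,Φ}·Γ₂′ⁿ·K̲²·T_{n+2,l}(x)` (`F3Bounds.boundH2Phi`), instead of the printed cell (3.74) `… + ᾱ_F·β_{ΔR,Φ}·K̲²·T_{n+2,l}(x)`, which the
tree reaches only under (H-Γ) `Γ₂′ⁿ·β_{R,Φ} ≤ β_{ΔR,Φ}` (`NobleWeightedDiagramBoundPhi`, module docstring).  Nothing else changes: `boundH2Phi`
reads the same three `T` entries as `boundH2`, with non-negative coefficients on well-formed arguments.

## What is here (all proved, `d`-generic)

§1 READ-SET MONOTONICITY of `boundHD75Phi` at `n = 0, 1` (`boundHD75Phi_{zero,one}_le_of_entries`), node-independence on cell tables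
   (`boundHD75Phi_cell_irrel`) and `boundHD75Phi_eq_frozenAt` — twins of `F3BoundsCellReduction` §1–§2 / `F3BoundsTablesMonoAt`.
§2 `W_d`-INVARIANCE at `srwTrueAlt` and the split of `𝒳` (`boundHD75Phi_srwTrueAlt_spAct`, `…_shell_le`, `…_calX_le_of_nodes_of_Q`,
   `…_three_le_of_absCones`, `…_calX_le_of_nodes_of_absCones`) — twins of `F3BoundsCellSplitAlt` §1, §2, §4.
§3 THE CELL THEOREMS at `srwTrueAlt d α̲ ᾱ`: `boundHD75Phi_srwTrueAlt_{zero,one}_cell_le` (over `𝒳`, `CellDomAlt`), `…_one_zero_le` (origin,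
   `OriginDomAlt`), `…_{zero,one}_le_on` (a set `C`, `OnDomAlt`), `…_{zero,one}_at_le` (one node) — twins of `F3BoundsCellReductionAlt` §2–§3 and
   `F3BoundsCellSplitAlt` §3, hypotheses VERBATIM, conclusion with `boundHD75Phi`.
§4 THE POINTWISE MAJORANT `nobleH_le_boundHD75Phi_srwTrueAlt`: `d ≥ 9`, `p < p_c`, an admissible witness at well-formed `r`, `1 ≤ α̲_F`, `n ≤ 1` ⇒
   `ℋ^{n,l}_p(x) ≤ boundHD75Phi (srwTrueAlt d α̲_F ᾱ_F) n l x r` — twin of `nobleH_le_boundHD75_srwTrueAlt` WITHOUT (H-Γ).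
§5 THE `e_i` BRIDGE (lead RULING D11 (d), kernel-checked scratch `HOME/lead/NobleHSingle.lean`): `nobleH_single : ℋ^{n,l}_p(e_i) = ℋ^{n,l+1}_p(0)` and
   `nobleSupH_singleton_zero_succ`, parallel to the tree's `srwI_single` / `srwK_single` / `srwT_single` / `srwU_single`.
§6 THE `ℚ` MIRROR `CellNumQ.boundH2PhiQ`, `CellNumQ.boundHD75PhiQ` with `cast_boundHD75PhiQ` and the closing rule `boundHD75Phi_cell_le_of_ratLe`
   — twin of `F3BoundsCellNumQ` §2–§3.

## What is NOT here
No dimension, no table, no numeric value, no certificate.  Heartbeat census: every declaration is a short order-algebra step, a `gcongr`, a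
`push_cast; ring_nf` cast identity or a term-mode composition; nothing approaches 100 000; no option set.
-/

noncomputable section

namespace Literature.Probability.FitznerVanDerHofstad2017

open MeasureTheory Finset Real
open Literature.Barriers.CriticalPhenomena Literature.Probability.LatticeModels Literature.Probability.Percolation

namespace F3Bounds

/-! ### §1  Read-set monotonicity of `boundHD75Phi` at `n = 0, 1`, cell tables -/

section Entries

variable {ν : Type*}

/-- **`boundHD75Phi` at `(0,l)` is monotone in the TEN entries it reads**, across tables and nodes (twin of `boundHD75_zero_le_of_entries`).
[cite: FitznerVanDerHofstad2016NoBLE, §3.3.5 (3.71), (3.74), (3.77), (3.78), (3.86) pp. 1077–1079] -/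
theorem boundHD75Phi_zero_le_of_entries {τ τ' : Tables ν} {v v' : ν} {a : Args} (ha : a.WF) {l : ℕ}
    (hIM0 : τ.IM 0 l v ≤ τ'.IM 0 l v') (hIM0' : τ.IM 0 (l + 1) v ≤ τ'.IM 0 (l + 1) v')
    (hIMn : τ.IM (-1) l v ≤ τ'.IM (-1) l v')
    (hT2 : τ.T 2 l v ≤ τ'.T 2 l v') (hT2' : τ.T 2 (l + 1) v ≤ τ'.T 2 (l + 1) v') (hT1 : τ.T 1 l v ≤ τ'.T 1 l v')
    (hU2 : τ.U 2 l v ≤ τ'.U 2 l v') (hU3 : τ.U 3 l v ≤ τ'.U 3 l v')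
    (hK1 : τ.K 1 l v ≤ τ'.K 1 l v') (hK2 : τ.K 2 l v ≤ τ'.K 2 l v') :
    boundHD75Phi τ 0 l v a ≤ boundHD75Phi τ' 0 l v' a := by
  have hm := m3_nonneg a
  obtain ⟨hG, hcp, haf, hafx, hap, hRp, hRfD, hRpD, hK⟩ := ha
  simp only [boundHD75Phi, boundH1, boundH2Phi, boundH3, boundH4D75, boundH5]
  gcongr

/-- **`boundHD75Phi` at `(1,l)` is monotone in the TWELVE entries it reads**, across tables and nodes (twin of `boundHD75_one_le_of_entries`).
[cite: FitznerVanDerHofstad2016NoBLE, §3.3.5 (3.71), (3.74), (3.77), (3.78), (3.86) pp. 1077–1079] -/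
theorem boundHD75Phi_one_le_of_entries {τ τ' : Tables ν} {v v' : ν} {a : Args} (ha : a.WF) {l : ℕ}
    (hIM1 : τ.IM 1 l v ≤ τ'.IM 1 l v') (hIM0 : τ.IM 0 l v ≤ τ'.IM 0 l v')
    (hIM1' : τ.IM 1 (l + 1) v ≤ τ'.IM 1 (l + 1) v') (hIM0' : τ.IM 0 (l + 1) v ≤ τ'.IM 0 (l + 1) v')
    (hIM1'' : τ.IM 1 (l + 2) v ≤ τ'.IM 1 (l + 2) v')
    (hT3 : τ.T 3 l v ≤ τ'.T 3 l v') (hT3' : τ.T 3 (l + 1) v ≤ τ'.T 3 (l + 1) v') (hT2 : τ.T 2 l v ≤ τ'.T 2 l v')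
    (hU3 : τ.U 3 l v ≤ τ'.U 3 l v') (hU4 : τ.U 4 l v ≤ τ'.U 4 l v')
    (hK2 : τ.K 2 l v ≤ τ'.K 2 l v') (hK3 : τ.K 3 l v ≤ τ'.K 3 l v') :
    boundHD75Phi τ 1 l v a ≤ boundHD75Phi τ' 1 l v' a := by
  have hm := m3_nonneg a
  obtain ⟨hG, hcp, haf, hafx, hap, hRp, hRfD, hRpD, hK⟩ := ha
  simp only [boundHD75Phi, boundH1, boundH2Phi, boundH3, boundH4D75, boundH5]
  gcongr

/-- `boundHD75Phi` of the cell tables does not depend on the node (definitional; twin of `boundHD75_cell_irrel`).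
[cite: FitznerVanDerHofstad2016NoBLE, §3.3.5 (3.87) p. 1079 (cell suprema `sup_{x ∈ S}`)] -/
theorem boundHD75Phi_cell_irrel (IMc : ℤ → ℕ → ℝ) (Tc Uc Kc : ℕ → ℕ → ℝ) (n l : ℕ) (v w : ν) (a : Args) :
    boundHD75Phi (Tables.cell IMc Tc Uc Kc : Tables ν) n l v a = boundHD75Phi (Tables.cell IMc Tc Uc Kc) n l w a := rfl

/-- `boundHD75Phi` reads the table only at the node (twin of `boundHD75_eq_frozenAt`).
[cite: FitznerVanDerHofstad2016NoBLE, §3.3.5 (3.71)–(3.87) pp. 1075–1079 (every `BoundH[i](n,l,x)` reads the tables at `x`)] -/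
theorem boundHD75Phi_eq_frozenAt (τ : Tables ν) (n l : ℕ) (v : ν) (a : Args) :
    boundHD75Phi τ n l v a = boundHD75Phi (τ.frozenAt v) n l v a := rfl

end Entries

variable {d : ℕ} {afmin afmax : ℝ}

/-! ### §2  `W_d`-invariance of `boundHD75Phi` at the alternative true tables and the split of `𝒳` -/

/-- **`boundHD75Phi` at the alternative true tables is `W_d`-invariant in the node** (twin of `boundHD75_srwTrueAlt_spAct`).
[cite: FitznerVanDerHofstad2016NoBLE, §3.3.5 (3.71)–(3.87); (3.35)–(3.38) p. 1071] -/
theorem boundHD75Phi_srwTrueAlt_spAct (n l : ℕ) (τ : SgnPermPair d) (x : Fin d → ℤ) (a : Args) :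
    boundHD75Phi (srwTrueAlt d afmin afmax) n l (spAct τ x) a = boundHD75Phi (srwTrueAlt d afmin afmax) n l x a := by
  rw [boundHD75Phi_eq_frozenAt (srwTrueAlt d afmin afmax) (v := spAct τ x), boundHD75Phi_eq_frozenAt (srwTrueAlt d afmin afmax) (v := x),
    srwTrueAlt_frozenAt_spAct]
  rfl

/-- `x ↦ boundHD75Phi (srwTrueAlt d α̲ ᾱ) n l x a` is `W_d`-invariant. [cite: FitznerVanDerHofstad2016NoBLE, §3.3.5 (3.71)–(3.87); (3.35)–(3.38) p. 1071] -/
theorem spInvariant_boundHD75Phi_srwTrueAlt (n l : ℕ) (a : Args) :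
    SpInvariant (fun x => boundHD75Phi (srwTrueAlt d afmin afmax) n l x a) := fun τ x => boundHD75Phi_srwTrueAlt_spAct n l τ x a

/-- **The shell `‖x‖₁ = 2` POINTWISE** at the alternative true tables, `boundHD75Phi`: the cell inequality on the shell from its two values at
`2e₁` and `e₁+e₂` (twin of `boundHD75_srwTrueAlt_shell_le`).
[cite: FitznerVanDerHofstad2016NoBLE, §3.3.5 (3.87) p. 1079] [cite: FitznerVanDerHofstad2017, §2.5, notebook Percolation.nb (points `‖x‖₁ ≤ 2` of `𝒳`)] -/
theorem boundHD75Phi_srwTrueAlt_shell_le (hd : 2 ≤ d) {n l : ℕ} {a : Args} {b : ℝ}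
    (h2 : boundHD75Phi (srwTrueAlt d afmin afmax) n l (vecOfParts d [2]) a ≤ b)
    (h11 : boundHD75Phi (srwTrueAlt d afmin afmax) n l (classVec d 2 0) a ≤ b) :
    ∀ x : Fin d → ℤ, ∑ j, |x j| = 2 → boundHD75Phi (srwTrueAlt d afmin afmax) n l x a ≤ b := fun _ hx =>
  le_of_sum_abs_eq_two (spInvariant_boundHD75Phi_srwTrueAlt n l a) hd h2 h11 hx

/-- **The cell over `𝒳` from the two near values and the far cell `Q`**, `boundHD75Phi` at the alternative true tables (twin of
`boundHD75_srwTrueAlt_calX_le_of_nodes_of_Q`). [cite: FitznerVanDerHofstad2016NoBLE, §3.3.5 (3.87) p. 1079; §5.1 p. 1093] [cite: FitznerVanDerHofstad2017, §2.5, notebook Percolation.nb] -/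
theorem boundHD75Phi_srwTrueAlt_calX_le_of_nodes_of_Q (hd : 2 ≤ d) {n l : ℕ} {a : Args} {b : ℝ}
    (h2 : boundHD75Phi (srwTrueAlt d afmin afmax) n l (vecOfParts d [2]) a ≤ b)
    (h11 : boundHD75Phi (srwTrueAlt d afmin afmax) n l (classVec d 2 0) a ≤ b)
    (hQ : ∀ x : Fin d → ℤ, 3 ≤ ∑ j, |x j| → boundHD75Phi (srwTrueAlt d afmin afmax) n l x a ≤ b) :
    ∀ x ∈ calX d, boundHD75Phi (srwTrueAlt d afmin afmax) n l x a ≤ b :=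
  forall_mem_calX_iff_shell_and_Q.mpr ⟨boundHD75Phi_srwTrueAlt_shell_le hd h2 h11, hQ⟩

/-- **Three cone bounds ⇒ the cell bound on all of `Q = {‖x‖₁ ≥ 3}`**, `boundHD75Phi` at the alternative true tables (twin of
`boundHD75_srwTrueAlt_three_le_of_absCones`). [cite: FitznerVanDerHofstad2016NoBLE, §3.3.5 (3.87) p. 1079; §5.1 p. 1093] [cite: FitznerVanDerHofstad2017, §2.5, notebook Percolation.nb (`boundF3[2,o]`, `boundF3[3,o]` read per cone)] -/
theorem boundHD75Phi_srwTrueAlt_three_le_of_absCones (hd : 3 ≤ d) {n l : ℕ} {a : Args} {b : ℝ}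
    (h3 : ∀ x ∈ absCone (vecOfParts d [3]), boundHD75Phi (srwTrueAlt d afmin afmax) n l x a ≤ b)
    (h21 : ∀ x ∈ absCone (vecOfParts d [2, 1]), boundHD75Phi (srwTrueAlt d afmin afmax) n l x a ≤ b)
    (h111 : ∀ x ∈ absCone (vecOfParts d [1, 1, 1]), boundHD75Phi (srwTrueAlt d afmin afmax) n l x a ≤ b) :
    ∀ x : Fin d → ℤ, 3 ≤ ∑ j, |x j| → boundHD75Phi (srwTrueAlt d afmin afmax) n l x a ≤ b :=
  forall_three_le_of_absCones hd (P := fun x => boundHD75Phi (srwTrueAlt d afmin afmax) n l x a ≤ b)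
    (fun τ x h => by rwa [boundHD75Phi_srwTrueAlt_spAct] at h) h3 h21 h111

/-- **Shell nodes + three cones ⇒ the cell bound on all of `𝒳`**, `boundHD75Phi` at the alternative true tables (twin of
`boundHD75_srwTrueAlt_calX_le_of_nodes_of_absCones`). [cite: FitznerVanDerHofstad2016NoBLE, §3.3.5 (3.87) p. 1079; §5.1 p. 1093] [cite: FitznerVanDerHofstad2017, (2.21)–(2.23); §2.5, notebook Percolation.nb] -/
theorem boundHD75Phi_srwTrueAlt_calX_le_of_nodes_of_absCones (hd : 3 ≤ d) {n l : ℕ} {a : Args} {b : ℝ}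
    (h2 : boundHD75Phi (srwTrueAlt d afmin afmax) n l (vecOfParts d [2]) a ≤ b)
    (h11 : boundHD75Phi (srwTrueAlt d afmin afmax) n l (classVec d 2 0) a ≤ b)
    (h3 : ∀ x ∈ absCone (vecOfParts d [3]), boundHD75Phi (srwTrueAlt d afmin afmax) n l x a ≤ b)
    (h21 : ∀ x ∈ absCone (vecOfParts d [2, 1]), boundHD75Phi (srwTrueAlt d afmin afmax) n l x a ≤ b)
    (h111 : ∀ x ∈ absCone (vecOfParts d [1, 1, 1]), boundHD75Phi (srwTrueAlt d afmin afmax) n l x a ≤ b) :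
    ∀ x ∈ calX d, boundHD75Phi (srwTrueAlt d afmin afmax) n l x a ≤ b :=
  boundHD75Phi_srwTrueAlt_calX_le_of_nodes_of_Q (by omega) h2 h11 (boundHD75Phi_srwTrueAlt_three_le_of_absCones hd h3 h21 h111)

/-! ### §3  The cell theorems at the alternative true tables, `boundHD75Phi` -/

/-- **The cell `(0,l)` over `𝒳`, `boundHD75Phi`, at the ALTERNATIVE true tables** (twin of `boundHD75_srwTrueAlt_zero_cell_le`, hypotheses verbatim):
conclude `boundHD75Phi (srwTrueAlt d α̲ ᾱ) 0 l x a ≤ b` for every `x ∈ 𝒳`.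
[cite: FitznerVanDerHofstad2016NoBLE, §3.3.5 (3.87) p. 1079; (3.71)–(3.86)] [cite: FitznerVanDerHofstad2017, §2.5; notebook General.nb In[2]–In[3]] -/
theorem boundHD75Phi_srwTrueAlt_zero_cell_le (hd : 9 ≤ d) (hα : 0 < afmin) (hᾱ : 1 ≤ afmax) {a : Args} (ha : a.WF)
    {IMc : ℤ → ℕ → ℝ} {Tc Uc Kc : ℕ → ℕ → ℝ} {l : ℕ} {b : ℝ}
    (hE0 : CellDomAlt d afmin afmax 0 l (IMc 0 l)) (hE0' : CellDomAlt d afmin afmax 0 (l + 1) (IMc 0 (l + 1)))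
    (hN1 : srwINode2 d 1 (l + 1) + srwIShift2Node2 d 2 l / (2 * (d : ℝ) ^ 2 * afmin) ≤ IMc (-1) l)
    (hN2 : srwINode2 d 2 l ≤ d * afmin * IMc (-1) l)
    (hT2 : ∀ x ∈ calX d, srwTS d afmin 2 l x ≤ Tc 2 l) (hT2' : ∀ x ∈ calX d, srwTS d afmin 2 (l + 1) x ≤ Tc 2 (l + 1))
    (hT1 : ∀ x ∈ calX d, srwTS d afmin 1 l x ≤ Tc 1 l)
    (hU2 : ∀ x ∈ calX d, srwU d 2 l x ≤ Uc 2 l) (hU3 : ∀ x ∈ calX d, srwU d 3 l x ≤ Uc 3 l)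
    (hK1 : ∀ x ∈ calX d, srwK d 1 l x ≤ Kc 1 l) (hK2 : ∀ x ∈ calX d, srwK d 2 l x ≤ Kc 2 l)
    (hnum : boundHD75Phi (Tables.cell IMc Tc Uc Kc : Tables (Fin d → ℤ)) 0 l 0 a ≤ b) :
    ∀ x ∈ calX d, boundHD75Phi (srwTrueAlt d afmin afmax) 0 l x a ≤ b := by
  intro x hx
  refine le_trans ?_ ((boundHD75Phi_cell_irrel IMc Tc Uc Kc 0 l x 0 a).le.trans hnum)
  have hneg : (srwTrueAlt d afmin afmax).IM (-1) l x ≤ IMc (-1) l := by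
    rw [srwTrueAlt_IM_negOne]; exact srwTrue_IM_negOne_le_of_cell hα (by omega) hN1 hN2 hx
  exact boundHD75Phi_zero_le_of_entries ha
    (srwTrueAlt_IM_natCast_le_of_cellDomAlt hα hᾱ (by omega) hE0 hx)
    (srwTrueAlt_IM_natCast_le_of_cellDomAlt hα hᾱ (by omega) hE0' hx)
    hneg (hT2 x hx) (hT2' x hx) (hT1 x hx) (hU2 x hx) (hU3 x hx) (hK1 x hx) (hK2 x hx)

/-- **The cells `(1,l)` over `𝒳`, `boundHD75Phi`, at the ALTERNATIVE true tables** (twin of `boundHD75_srwTrueAlt_one_cell_le`, hypotheses verbatim).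
[cite: FitznerVanDerHofstad2016NoBLE, §3.3.5 (3.87) p. 1079; (3.71)–(3.86)] [cite: FitznerVanDerHofstad2017, §2.5; notebook General.nb In[2]–In[3]] -/
theorem boundHD75Phi_srwTrueAlt_one_cell_le (hd : 9 ≤ d) (hα : 0 < afmin) (hᾱ : 1 ≤ afmax) {a : Args} (ha : a.WF)
    {IMc : ℤ → ℕ → ℝ} {Tc Uc Kc : ℕ → ℕ → ℝ} {l : ℕ} {b : ℝ}
    (hE1 : CellDomAlt d afmin afmax 1 l (IMc 1 l)) (hE0 : CellDomAlt d afmin afmax 0 l (IMc 0 l))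
    (hE1' : CellDomAlt d afmin afmax 1 (l + 1) (IMc 1 (l + 1))) (hE0' : CellDomAlt d afmin afmax 0 (l + 1) (IMc 0 (l + 1)))
    (hE1'' : CellDomAlt d afmin afmax 1 (l + 2) (IMc 1 (l + 2)))
    (hT3 : ∀ x ∈ calX d, srwTS d afmin 3 l x ≤ Tc 3 l) (hT3' : ∀ x ∈ calX d, srwTS d afmin 3 (l + 1) x ≤ Tc 3 (l + 1))
    (hT2 : ∀ x ∈ calX d, srwTS d afmin 2 l x ≤ Tc 2 l)
    (hU3 : ∀ x ∈ calX d, srwU d 3 l x ≤ Uc 3 l) (hU4 : ∀ x ∈ calX d, srwU d 4 l x ≤ Uc 4 l)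
    (hK2 : ∀ x ∈ calX d, srwK d 2 l x ≤ Kc 2 l) (hK3 : ∀ x ∈ calX d, srwK d 3 l x ≤ Kc 3 l)
    (hnum : boundHD75Phi (Tables.cell IMc Tc Uc Kc : Tables (Fin d → ℤ)) 1 l 0 a ≤ b) :
    ∀ x ∈ calX d, boundHD75Phi (srwTrueAlt d afmin afmax) 1 l x a ≤ b := by
  intro x hx
  refine le_trans ?_ ((boundHD75Phi_cell_irrel IMc Tc Uc Kc 1 l x 0 a).le.trans hnum)
  exact boundHD75Phi_one_le_of_entries ha
    (srwTrueAlt_IM_natCast_le_of_cellDomAlt hα hᾱ (by omega) hE1 hx)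
    (srwTrueAlt_IM_natCast_le_of_cellDomAlt hα hᾱ (by omega) hE0 hx)
    (srwTrueAlt_IM_natCast_le_of_cellDomAlt hα hᾱ (by omega) hE1' hx)
    (srwTrueAlt_IM_natCast_le_of_cellDomAlt hα hᾱ (by omega) hE0' hx)
    (srwTrueAlt_IM_natCast_le_of_cellDomAlt hα hᾱ (by omega) hE1'' hx)
    (hT3 x hx) (hT3' x hx) (hT2 x hx) (hU3 x hx) (hU4 x hx) (hK2 x hx) (hK3 x hx)

/-- **The `x = 0` cell `(1,l)`, `boundHD75Phi`, at the ALTERNATIVE true tables** from the entry values AT THE ORIGIN (twin of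
`boundHD75_srwTrueAlt_one_zero_le`, hypotheses verbatim).
[cite: FitznerVanDerHofstad2016NoBLE, §3.3.5 (3.87) p. 1079 (cell `{0}`); (3.30), (3.35)] [cite: FitznerVanDerHofstad2017, §2.5] -/
theorem boundHD75Phi_srwTrueAlt_one_zero_le (hd : 1 ≤ d) (hα : 0 < afmin) {a : Args} (ha : a.WF)
    {IMc : ℤ → ℕ → ℝ} {Tc Uc Kc : ℕ → ℕ → ℝ} {l : ℕ} {b : ℝ}
    (hE1 : OriginDomAlt d afmin afmax 1 l (IMc 1 l)) (hE0 : OriginDomAlt d afmin afmax 0 l (IMc 0 l))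
    (hE1' : OriginDomAlt d afmin afmax 1 (l + 1) (IMc 1 (l + 1))) (hE0' : OriginDomAlt d afmin afmax 0 (l + 1) (IMc 0 (l + 1)))
    (hE1'' : OriginDomAlt d afmin afmax 1 (l + 2) (IMc 1 (l + 2)))
    (hT3 : srwTS d afmin 3 l 0 ≤ Tc 3 l) (hT3' : srwTS d afmin 3 (l + 1) 0 ≤ Tc 3 (l + 1)) (hT2 : srwTS d afmin 2 l 0 ≤ Tc 2 l)
    (hU3 : srwU d 3 l 0 ≤ Uc 3 l) (hU4 : srwU d 4 l 0 ≤ Uc 4 l) (hK2 : srwK d 2 l 0 ≤ Kc 2 l) (hK3 : srwK d 3 l 0 ≤ Kc 3 l)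
    (hnum : boundHD75Phi (Tables.cell IMc Tc Uc Kc : Tables (Fin d → ℤ)) 1 l 0 a ≤ b) :
    boundHD75Phi (srwTrueAlt d afmin afmax) 1 l 0 a ≤ b := by
  refine le_trans ?_ hnum
  exact boundHD75Phi_one_le_of_entries ha (srwTrueAlt_IM_natCast_zero_le_of_originDomAlt hd hα hE1)
    (srwTrueAlt_IM_natCast_zero_le_of_originDomAlt hd hα hE0) (srwTrueAlt_IM_natCast_zero_le_of_originDomAlt hd hα hE1')
    (srwTrueAlt_IM_natCast_zero_le_of_originDomAlt hd hα hE0') (srwTrueAlt_IM_natCast_zero_le_of_originDomAlt hd hα hE1'')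
    hT3 hT3' hT2 hU3 hU4 hK2 hK3

/-- **Cell `(0,l)` over an arbitrary set `C`, `boundHD75Phi`, at the ALTERNATIVE true tables** (twin of `boundHD75_srwTrueAlt_zero_le_on`).
[cite: FitznerVanDerHofstad2016NoBLE, §3.3.5 (3.87) p. 1079; (3.71)–(3.86)] -/
theorem boundHD75Phi_srwTrueAlt_zero_le_on (hd : 1 ≤ d) (hα : 0 < afmin) (hᾱ : 1 ≤ afmax) {a : Args} (ha : a.WF) (C : Set (Fin d → ℤ))
    {IMc : ℤ → ℕ → ℝ} {Tc Uc Kc : ℕ → ℕ → ℝ} {l : ℕ} {b : ℝ}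
    (hE0 : OnDomAlt d afmin afmax C 0 l (IMc 0 l)) (hE0' : OnDomAlt d afmin afmax C 0 (l + 1) (IMc 0 (l + 1)))
    (hN1 : ∀ x ∈ C, srwI d 1 (l + 1) x + srwIShift2 d 2 l x / (2 * (d : ℝ) ^ 2 * afmin) ≤ IMc (-1) l)
    (hN2 : ∀ x ∈ C, srwI d 2 l x ≤ d * afmin * IMc (-1) l)
    (hT2 : ∀ x ∈ C, srwTS d afmin 2 l x ≤ Tc 2 l) (hT2' : ∀ x ∈ C, srwTS d afmin 2 (l + 1) x ≤ Tc 2 (l + 1))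
    (hT1 : ∀ x ∈ C, srwTS d afmin 1 l x ≤ Tc 1 l)
    (hU2 : ∀ x ∈ C, srwU d 2 l x ≤ Uc 2 l) (hU3 : ∀ x ∈ C, srwU d 3 l x ≤ Uc 3 l)
    (hK1 : ∀ x ∈ C, srwK d 1 l x ≤ Kc 1 l) (hK2 : ∀ x ∈ C, srwK d 2 l x ≤ Kc 2 l)
    (hnum : boundHD75Phi (Tables.cell IMc Tc Uc Kc : Tables (Fin d → ℤ)) 0 l 0 a ≤ b) :
    ∀ x ∈ C, boundHD75Phi (srwTrueAlt d afmin afmax) 0 l x a ≤ b := by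
  intro x hx
  refine le_trans ?_ ((boundHD75Phi_cell_irrel IMc Tc Uc Kc 0 l x 0 a).le.trans hnum)
  have hneg : (srwTrueAlt d afmin afmax).IM (-1) l x ≤ IMc (-1) l := by
    rw [srwTrueAlt_IM_negOne]; exact srwTrue_IM_negOne_le hd hα (hN1 x hx) (hN2 x hx)
  exact boundHD75Phi_zero_le_of_entries ha
    (srwTrueAlt_IM_natCast_le_of_onDomAlt hd hα hᾱ hE0 hx) (srwTrueAlt_IM_natCast_le_of_onDomAlt hd hα hᾱ hE0' hx)
    hneg (hT2 x hx) (hT2' x hx) (hT1 x hx) (hU2 x hx) (hU3 x hx) (hK1 x hx) (hK2 x hx)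

/-- **Cells `(1,l)` over an arbitrary set `C`, `boundHD75Phi`, at the ALTERNATIVE true tables** (twin of `boundHD75_srwTrueAlt_one_le_on`).
[cite: FitznerVanDerHofstad2016NoBLE, §3.3.5 (3.87) p. 1079; (3.71)–(3.86)] -/
theorem boundHD75Phi_srwTrueAlt_one_le_on (hd : 1 ≤ d) (hα : 0 < afmin) (hᾱ : 1 ≤ afmax) {a : Args} (ha : a.WF) (C : Set (Fin d → ℤ))
    {IMc : ℤ → ℕ → ℝ} {Tc Uc Kc : ℕ → ℕ → ℝ} {l : ℕ} {b : ℝ}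
    (hE1 : OnDomAlt d afmin afmax C 1 l (IMc 1 l)) (hE0 : OnDomAlt d afmin afmax C 0 l (IMc 0 l))
    (hE1' : OnDomAlt d afmin afmax C 1 (l + 1) (IMc 1 (l + 1))) (hE0' : OnDomAlt d afmin afmax C 0 (l + 1) (IMc 0 (l + 1)))
    (hE1'' : OnDomAlt d afmin afmax C 1 (l + 2) (IMc 1 (l + 2)))
    (hT3 : ∀ x ∈ C, srwTS d afmin 3 l x ≤ Tc 3 l) (hT3' : ∀ x ∈ C, srwTS d afmin 3 (l + 1) x ≤ Tc 3 (l + 1))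
    (hT2 : ∀ x ∈ C, srwTS d afmin 2 l x ≤ Tc 2 l)
    (hU3 : ∀ x ∈ C, srwU d 3 l x ≤ Uc 3 l) (hU4 : ∀ x ∈ C, srwU d 4 l x ≤ Uc 4 l)
    (hK2 : ∀ x ∈ C, srwK d 2 l x ≤ Kc 2 l) (hK3 : ∀ x ∈ C, srwK d 3 l x ≤ Kc 3 l)
    (hnum : boundHD75Phi (Tables.cell IMc Tc Uc Kc : Tables (Fin d → ℤ)) 1 l 0 a ≤ b) :
    ∀ x ∈ C, boundHD75Phi (srwTrueAlt d afmin afmax) 1 l x a ≤ b := by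
  intro x hx
  refine le_trans ?_ ((boundHD75Phi_cell_irrel IMc Tc Uc Kc 1 l x 0 a).le.trans hnum)
  exact boundHD75Phi_one_le_of_entries ha
    (srwTrueAlt_IM_natCast_le_of_onDomAlt hd hα hᾱ hE1 hx) (srwTrueAlt_IM_natCast_le_of_onDomAlt hd hα hᾱ hE0 hx)
    (srwTrueAlt_IM_natCast_le_of_onDomAlt hd hα hᾱ hE1' hx) (srwTrueAlt_IM_natCast_le_of_onDomAlt hd hα hᾱ hE0' hx)
    (srwTrueAlt_IM_natCast_le_of_onDomAlt hd hα hᾱ hE1'' hx)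
    (hT3 x hx) (hT3' x hx) (hT2 x hx) (hU3 x hx) (hU4 x hx) (hK2 x hx) (hK3 x hx)

/-- **Cell `(0,l)` AT ONE NODE `y`, `boundHD75Phi`, at the ALTERNATIVE true tables** (twin of `boundHD75_srwTrueAlt_zero_at_le`).
[cite: FitznerVanDerHofstad2016NoBLE, §3.3.5 (3.87) p. 1079; (3.71)–(3.86)] [cite: FitznerVanDerHofstad2017, §2.5, notebook Percolation.nb] -/
theorem boundHD75Phi_srwTrueAlt_zero_at_le (hd : 1 ≤ d) (hα : 0 < afmin) {a : Args} (ha : a.WF) (y : Fin d → ℤ)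
    {IMc : ℤ → ℕ → ℝ} {Tc Uc Kc : ℕ → ℕ → ℝ} {l : ℕ} {b : ℝ}
    (hE0 : (srwTrueAlt d afmin afmax).IM 0 l y ≤ IMc 0 l) (hE0' : (srwTrueAlt d afmin afmax).IM 0 (l + 1) y ≤ IMc 0 (l + 1))
    (hN1 : srwI d 1 (l + 1) y + srwIShift2 d 2 l y / (2 * (d : ℝ) ^ 2 * afmin) ≤ IMc (-1) l)
    (hN2 : srwI d 2 l y ≤ d * afmin * IMc (-1) l)
    (hT2 : srwTS d afmin 2 l y ≤ Tc 2 l) (hT2' : srwTS d afmin 2 (l + 1) y ≤ Tc 2 (l + 1)) (hT1 : srwTS d afmin 1 l y ≤ Tc 1 l)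
    (hU2 : srwU d 2 l y ≤ Uc 2 l) (hU3 : srwU d 3 l y ≤ Uc 3 l) (hK1 : srwK d 1 l y ≤ Kc 1 l) (hK2 : srwK d 2 l y ≤ Kc 2 l)
    (hnum : boundHD75Phi (Tables.cell IMc Tc Uc Kc : Tables (Fin d → ℤ)) 0 l 0 a ≤ b) :
    boundHD75Phi (srwTrueAlt d afmin afmax) 0 l y a ≤ b := by
  refine le_trans ?_ ((boundHD75Phi_cell_irrel IMc Tc Uc Kc 0 l y 0 a).le.trans hnum)
  have hneg : (srwTrueAlt d afmin afmax).IM (-1) l y ≤ IMc (-1) l := by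
    rw [srwTrueAlt_IM_negOne]; exact srwTrue_IM_negOne_le hd hα hN1 hN2
  exact boundHD75Phi_zero_le_of_entries ha hE0 hE0' hneg hT2 hT2' hT1 hU2 hU3 hK1 hK2

/-- **Cells `(1,l)` AT ONE NODE `y`, `boundHD75Phi`, at the ALTERNATIVE true tables** (twin of `boundHD75_srwTrueAlt_one_at_le`).
[cite: FitznerVanDerHofstad2016NoBLE, §3.3.5 (3.87) p. 1079; (3.71)–(3.86)] [cite: FitznerVanDerHofstad2017, §2.5, notebook Percolation.nb] -/
theorem boundHD75Phi_srwTrueAlt_one_at_le {a : Args} (ha : a.WF) (y : Fin d → ℤ)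
    {IMc : ℤ → ℕ → ℝ} {Tc Uc Kc : ℕ → ℕ → ℝ} {l : ℕ} {b : ℝ}
    (hE1 : (srwTrueAlt d afmin afmax).IM 1 l y ≤ IMc 1 l) (hE0 : (srwTrueAlt d afmin afmax).IM 0 l y ≤ IMc 0 l)
    (hE1' : (srwTrueAlt d afmin afmax).IM 1 (l + 1) y ≤ IMc 1 (l + 1)) (hE0' : (srwTrueAlt d afmin afmax).IM 0 (l + 1) y ≤ IMc 0 (l + 1))
    (hE1'' : (srwTrueAlt d afmin afmax).IM 1 (l + 2) y ≤ IMc 1 (l + 2))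
    (hT3 : srwTS d afmin 3 l y ≤ Tc 3 l) (hT3' : srwTS d afmin 3 (l + 1) y ≤ Tc 3 (l + 1)) (hT2 : srwTS d afmin 2 l y ≤ Tc 2 l)
    (hU3 : srwU d 3 l y ≤ Uc 3 l) (hU4 : srwU d 4 l y ≤ Uc 4 l) (hK2 : srwK d 2 l y ≤ Kc 2 l) (hK3 : srwK d 3 l y ≤ Kc 3 l)
    (hnum : boundHD75Phi (Tables.cell IMc Tc Uc Kc : Tables (Fin d → ℤ)) 1 l 0 a ≤ b) :
    boundHD75Phi (srwTrueAlt d afmin afmax) 1 l y a ≤ b := by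
  refine le_trans ?_ ((boundHD75Phi_cell_irrel IMc Tc Uc Kc 1 l y 0 a).le.trans hnum)
  exact boundHD75Phi_one_le_of_entries ha hE1 hE0 hE1' hE0' hE1'' hT3 hT3' hT2 hU3 hU4 hK2 hK3

end F3Bounds

/-! ### §4  The pointwise majorant at the alternative true tables, without (H-Γ) -/

variable {d : ℕ}

open F3Bounds in
/-- **The pointwise majorant at the ALTERNATIVE TRUE tables, `h2phi` form**: for `d ≥ 9`, `p < p_c`, an admissible witness at well-formed `r` and
`1 ≤ α̲_F`, `ℋ^{n,l}_p(x) ≤ boundHD75Phi (srwTrueAlt d α̲_F ᾱ_F) n l x r` for `n ≤ 1` and all `l`, `x` — twin of `nobleH_le_boundHD75_srwTrueAlt`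
WITHOUT the hypothesis (H-Γ) `Γ₂′ⁿ·β_{R,Φ} ≤ β_{ΔR,Φ}`: Step 2 is read by `abs_nobleH_le_boundHD75Phi_of_witness`, every table-side condition (`K`, `U`,
(H-T), the per-key alternative `SlotAlt`, (H-IM1), (H-low1)) discharged by `NobleF3TrueTablesAlt` §3 exactly as there.
[cite: FitznerVanDerHofstad2016NoBLE, §3.3.5 (3.58)–(3.59) p. 1074 and (3.60)–(3.87) pp. 1075–1079; §3.3.4 Step 2 p. 1077] [cite: FitznerVanDerHofstad2017, §2.5; notebook General.nb `BoundHn`] -/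
theorem nobleH_le_boundHD75Phi_srwTrueAlt (hd : 9 ≤ d) {p : unitInterval} (hp : (p : ℝ) < criticalProb (zdGraph d) (0 : Site d))
    {B : NobleBeta} {E : NobleBetaF3} {r : F3Bounds.Args}
    (hW : ∃ (cΦ αΦ cF αF : ℝ) (RΦ RF : Site d → ℝ), NobleF3Witness d p B E r cΦ αΦ cF αF RΦ RF)
    (hr : r.WF) (hα1 : 1 ≤ r.afmin) {n : ℕ} (hn : n ≤ 1) (l : ℕ) (x : Site d) :
    nobleH d n l p x ≤ boundHD75Phi (srwTrueAlt d r.afmin r.afmax) n l x r :=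
  have hd1 : 1 ≤ d := by omega
  have hα : 0 < r.afmin := lt_of_lt_of_le one_pos hα1
  (le_abs_self _).trans
    (abs_nobleH_le_boundHD75Phi_of_witness (n := n) (by omega) hp hW hr (srwTrueAlt d r.afmin r.afmax)
      (fun _ _ _ => rfl) (fun _ _ _ => rfl) (fun m j y => srwTS_le_srwTrueAlt_T m j y) l x
      (NobleF3Witness.step1_of_alt_tables hd hα1 (srwTrueAlt d r.afmin r.afmax)
        (fun m j y _ => slotAlt_srwTrueAlt hd1 hα m j y) (fun j y => srwI_add_le_srwTrueAlt_IM_negOne j y)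
        (fun j y => srwI_two_le_mul_srwTrueAlt_IM_negOne hd1 hα j y) (fun m j y => srwTS_le_srwTrueAlt_T m j y) n hn l x))

/-! ### §5  The `e_i` bridge `ℋ^{n,l}_p(e_i) = ℋ^{n,l+1}_p(0)` -/

/-- **`ℋ^{n,l}_p(e_i) = ℋ^{n,l+1}_p(0)` below `p_c`** (`d ≥ 2`): in the Fourier representation `D̂^{(e_i)} = D̂` and `D̂^{(0)} = 1` — so the family cell
`(n, l+1, {0})` is the `e_i`-node value of the cell `(n, l)` (parallel to `srwI_single`, `srwK_single`, `srwT_single`, `srwU_single`).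
[cite: FitznerVanDerHofstad2016NoBLE, §3.3.4 (3.34)–(3.35) p. 1071] -/
theorem nobleH_single (hd : 2 ≤ d) (n l : ℕ) (p : unitInterval)
    (hp : (p : ℝ) < criticalProb (zdGraph d) (0 : Site d)) (i : Fin d) :
    nobleH d n l p (Pi.single i 1) = nobleH d n (l + 1) p 0 := by
  rw [nobleH_eq_integral hd n l p hp, nobleH_eq_integral hd n (l + 1) p hp]
  congr 1
  refine integral_congr_ae (ae_of_all _ fun k => ?_)
  simp only [DhatSym_single, DhatSym_zero, one_mul, pow_succ]
  ring

/-- Hence the singleton cell at the origin one column further is the `e_i`-node value: `sup_{x ∈ {0}} ℋ^{n,l+1}_p(x) = ℋ^{n,l}_p(e_i)`.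
[cite: FitznerVanDerHofstad2016NoBLE, §3.3.4 (3.34)–(3.35) p. 1071] [cite: FitznerVanDerHofstad2017, (2.23) (the cells `{n,l,S}` with `S = {0}`)] -/
theorem nobleSupH_singleton_zero_succ (hd : 2 ≤ d) (n l : ℕ) (p : unitInterval)
    (hp : (p : ℝ) < criticalProb (zdGraph d) (0 : Site d)) (i : Fin d) :
    nobleSupH d n (l + 1) ({0} : Set (Site d)) p = nobleH d n l p (Pi.single i 1) := by
  rw [nobleSupH_singleton, nobleH_single hd n l p hp i]

/-! ### §6  The `ℚ` mirror of `boundHD75Phi` on cell tables and its closing rule -/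

namespace F3Bounds

namespace CellNumQ

section Map

variable (IMq : ℤ → ℕ → ℚ) (Tq Uq Kq : ℕ → ℕ → ℚ)

/-- ℚ mirror of `F3Bounds.boundH2Phi` (Step 2 in the form proved by `NobleH2Step.abs_integral_H2_diagram_le`: last term `ᾱ_F·β_{R,Φ}·Γ₂′ⁿ·K̲²·T_{n+2,l}`)
on cell tables. [cite: FitznerVanDerHofstad2016NoBLE, §3.3.5 (3.73)–(3.74) p. 1077 with (3.53) p. 1073] -/
def boundH2PhiQ (n l : ℕ) (a : ArgsQ) : ℚ :=
  a.bRfDelta * a.Gamma2dash ^ n * a.Kunderline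
      * ((a.cp * Tq (n+2) l + a.ap * Tq (n+2) (l+1)) * (1 / a.afmin + a.Kunderline)
          + a.ap / a.afmin * Tq (n+1) l)
    + a.afmax * a.bRp * a.Gamma2dash ^ n * a.Kunderline ^ 2 * Tq (n+2) l

/-- ℚ mirror of `F3Bounds.boundHD75Phi = H1 + H2Phi + H3 + H4D75 + H5` on cell tables.
[cite: FitznerVanDerHofstad2016NoBLE, §3.3.5 (3.87) p. 1079; (3.71), (3.73)–(3.74), (3.77), (3.78), (3.86)] -/
def boundHD75PhiQ (n l : ℕ) (a : ArgsQ) : ℚ :=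
  boundH1Q IMq Tq n l a + boundH2PhiQ Tq n l a + boundH3Q Uq n l a + boundH4Q Kq n l a + boundH5Q Uq n l a

variable {ν : Type*} (v : ν)

/-- `boundH2PhiQ` casts to `boundH2Phi` of the cell tables at the cast arguments. [cite: FitznerVanDerHofstad2016NoBLE, §3.3.5 (3.73)–(3.74) p. 1077] -/
theorem cast_boundH2PhiQ (n l : ℕ) (a : ArgsQ) :
    ((boundH2PhiQ Tq n l a : ℚ) : ℝ) = boundH2Phi (cellQ IMq Tq Uq Kq : Tables ν) n l v a.toArgs := by
  simp only [boundH2PhiQ, boundH2Phi, cellQ, Tables.cell_T, ArgsQ.toArgs]; push_cast; ring_nf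

/-- **`boundHD75PhiQ` casts to the cell numeral `boundHD75Phi (Tables.cell ↑IMq ↑Tq ↑Uq ↑Kq) n l v a.toArgs`** (any node `v`).
[cite: FitznerVanDerHofstad2016NoBLE, §3.3.5 (3.87) p. 1079] -/
theorem cast_boundHD75PhiQ (n l : ℕ) (a : ArgsQ) :
    ((boundHD75PhiQ IMq Tq Uq Kq n l a : ℚ) : ℝ) = boundHD75Phi (cellQ IMq Tq Uq Kq : Tables ν) n l v a.toArgs := by
  simp only [boundHD75PhiQ, boundHD75Phi, Rat.cast_add, cast_boundH1Q IMq Tq Uq Kq v, cast_boundH2PhiQ IMq Tq Uq Kq v,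
    cast_boundH3Q IMq Tq Uq Kq v, cast_boundH4Q IMq Tq Uq Kq v, cast_boundH5Q IMq Tq Uq Kq v]

/-- **The closing rule**: a (kernel-)decided `boundHD75PhiQ IMq Tq Uq Kq n l a ≤ b` gives the real closing numeral
`boundHD75Phi (Tables.cell ↑IMq ↑Tq ↑Uq ↑Kq) n l v a.toArgs ≤ b` of the cell theorems of §3 (`hnum`).
[cite: FitznerVanDerHofstad2016NoBLE, §3.3.5 (3.87) p. 1079] [cite: FitznerVanDerHofstad2017, §2.5 (entrywise numerical verification from rational data)] -/
theorem boundHD75Phi_cell_le_of_ratLe {n l : ℕ} {a : ArgsQ} {b : ℚ} (h : boundHD75PhiQ IMq Tq Uq Kq n l a ≤ b) :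
    boundHD75Phi (Tables.cell (fun m l => ((IMq m l : ℚ) : ℝ)) (fun m l => ((Tq m l : ℚ) : ℝ)) (fun m l => ((Uq m l : ℚ) : ℝ))
      (fun m l => ((Kq m l : ℚ) : ℝ)) : Tables ν) n l v a.toArgs ≤ ((b : ℚ) : ℝ) := by
  rw [← cellQ, ← cast_boundHD75PhiQ]; exact_mod_cast h

end Map

end CellNumQ

end F3Bounds

end Literature.Probability.FitznerVanDerHofstad2017

end
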